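import Literature.MathematicalPhysics.QuantumFieldTheory.Balaban1983to89.B6MultiLevelTorusMirrorBlockTiling
import Literature.MathematicalPhysics.QuantumFieldTheory.Balaban1983to89.B6Prop23MultiLevelTorusL0
import Literature.MathematicalPhysics.QuantumFieldTheory.Balaban1983to89.B6Ineq288MultiLevelTorusL0

/-!
# `Balaban1983to89.B6MultiLevelTorusMirrorBlockLetter` — [Balaban1984PropagatorsII] Prop. 2.3 (2.87) p. 238 «(Q′G′²Q′*)⁻¹» FOR THE REFLECTED FAMILY OF THE DOUBLED TORUS,
# FOLDED: the block word `X̂ = Q̂′Ĝ²Q̂′*` of g31's reflected family and its genuine inverse `Ĉ` are jointly invariant under the face reflections (sites `σ_ε`, blocks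
# `σ^{blk}_ε`), hence — by the fold engine over the SITE carrier thrice and over the BLOCK carrier once — the compression of the folded word to the blocks inside the open
# mirror box is INVERTED EXACTLY by the compressed fold of `Ĉ` ([Balaban1983RegularityDecay] (2.42) for a non-local letter; ROAD (I) «IMAGES», file D3f;
# towards [Balaban1985BackgroundPropagators] Thm 3.2 (3.48) for the Dirichlet `C_□(1)` of the cube sequence, p. 409 l. 1–5)

statement-level skeleton of published theorems with citation tags; proofs where landed; nothing here is a claim about the Yang–Mills mass gap

CITATION HEADER (lean-in-tree rule).  [4] = T. Bałaban, *Propagators and renormalization transformations for lattice gauge theories. II*, Commun. Math. Phys. **96** (1984)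
223–250 [`Balaban1984PropagatorsII`], (2.17) p. 225, (2.69) p. 235, Prop. 2.3 (2.86)–(2.88) p. 238 («its inverse is well defined»); [B4] = [`Balaban1983RegularityDecay`] (2.42) p. 584
(the multiple reflection method); [B9] = [`Balaban1985BackgroundPropagators`] p. 394 (Dirichlet conventions), (3.25) p. 394, Thm 3.2 (3.48) p. 398, p. 409 l. 1–5 («C_□(U)»).

WHY THIS FILE (cell `pub-ymgap`, node N06, seat dag-n06-c g33; FILES 5a `B4Eq242SignedImagesFold`, 5b-i `B4Eq242TorusMirrorsTiling`, 5b-iiA `B6MultiLevelTorusMirrorBlockTiling`).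
At `U = 1` the Dirichlet site letter `G′_□(1)` on `Ω₀(□)` IS the signed image fold of the torus Green's function `Ĝ` of g31's reflected cube family (`B9CubeDirichletLetterAtOne.
GpDirOne_apply_of_mem`); print's block letter `C_□(1) = (Q′G′_□(1)²Q′*)⁻¹` on the blocks INSIDE `Ω₀(□)` is therefore the inverse of the compression of the product of four
folds.  THIS FILE does the reflected-family half generically (any `F`, mirror datum, shift `g` with g31's standing binders, any admissible weights `a`): §1 the block
reflections of the reflected family (Part A's `blkRefl` at g31's `blkOf_trefl_eq_of_blkOf_eq`) and the invariance of `Q̂′ = QM`, `Q̂′* = QsM`; §2 the block word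
`X̂ := (kerOp W (XkT F′ a))` as the matrix `QM·Ĝ·Ĝ·QsM`, its genuine inverse `Ĉ := (GinvT F′ a)` (Prop. 2.3's operator, NO threshold: `isUnit_BmT`), both laws, both
invariances; §3 ★ the product of the four compressed folds is the compressed fold of `X̂` (engine §2 over the SITE carrier, FILE 5b-i's tiling ∕ cancellation);
§4 ★★★ the compressed fold of `X̂` times the compressed fold of `Ĉ` is `1` on the blocks inside the open box, both sides (engine §3 over the BLOCK carrier, Part A's
tiling ∕ cancellation under the MARGIN binder `hmarg`).  The cube instance (margin = g31 `margC`, identification with n06-j's `xDirMatY i □ Ω₀(□) GpDirOneY`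
on `insideBlkY`, the socket `hKX` discharged, the (3.48) decay from `prop23_multiLevelTorus` at the reflected family) is the next file.

WHAT IS PROVED (defs with bodies: `hblkR`-free — `blkReflR`, `xHat`, `cHat`; theorems; 0 sorry; 0 new named facts; standard axioms):
* §1 `blkOf_trefl_refl` (g31's compatibility in Part A's shape), `blkReflR`, `blkReflR_blkOf`, ★`QM_refl`, ★`QsM_refl`;
* §2 `xHat`, `cHat`, `xHat_eq` (`= QM·Ĝ·Ĝ·QsM`), ★`xHat_mul_cHat` ∕ `cHat_mul_xHat`, ★`xHat_refl`, ★`cHat_refl`;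
* §3 ★`fold_QM_mul_fold_G`, `fold_QMG_mul_fold_G`, ★★`fold_xHat_eq_prod` (the compressed fold of `X̂` = the product of the four compressed folds);
* §4 ★★★`compress_fold_xHat_mul_compress_fold_cHat` ∕ `…_comm` (both inverse laws on the inside blocks), `isUnit_compress_fold_xHat`.

HONEST SCOPE / NOT CLAIMED.  Bookkeeping over the engine and g31's reflected family; the MARGIN `hmarg` (a block of the reflected family meeting the open box lies in it)
is a hypothesis of §4 (the cube instance discharges it by `margC`); no estimate (the decay fold is the next file's); the weights `a` are parameters with the positivity ∕
window binders of `isUnit_BmT`.  Count-neutral; N06 NOT discharged; nothing on `d = 4`, the continuum, reflection positivity, the mass gap or Clay.  No `sorry`, no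
`axiom`, no `instance`, no `notation`.  Seat `pub-ymgap-dag-n06-c` g33, 2026-08-31; `--supports stmt-QuantumFields-27239`.

RELATED IN THE TREE, NOT DUPLICATED: g31 `B6MultiLevelTorusMirrorDirichlet ∕ ImageFold ∕ Decay` (site letter: `mlOpT_reflected_trefl`, `gmlT_reflected_trefl`, `avgK_trefl`,
`blkOf_trefl_eq_of_blkOf_eq` — USED), r05 `B9CubeLettersBondOpsAtOneL0.toMatrix_XkT_cube ∕ xK_mul_xinvKc` (the same `X̂`-bookkeeping for the ORIGINAL cube family),
`B6Prop23MultiLevelTorusL0` (`GinvT`, `X_mul_GinvT`, `isUnit_BmT` — USED), FILES 5a ∕ 5b-i ∕ 5b-iiA.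
-/

namespace Literature.MathematicalPhysics.QuantumFieldTheory.Balaban1983to89.B6MultiLevelTorusMirrorBlockLetter

noncomputable section

open Finset Matrix
open Literature.MathematicalPhysics.QuantumFieldTheory.Balaban1983to89.B4Reflection242 (boxDom mem_boxDom blk)
open Literature.MathematicalPhysics.QuantumFieldTheory.Balaban1983to89.B6MultiLevelBoxOperator (N0)
open Literature.MathematicalPhysics.QuantumFieldTheory.Balaban1983to89.B6MultiLevelTorusOperator (mlOpT gmlT mlOpT_mul_gmlT)
open Literature.MathematicalPhysics.QuantumFieldTheory.Balaban1983to89.B6MultiLevelTorusOperatorL0 (TDomains)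
open Literature.MathematicalPhysics.QuantumFieldTheory.Balaban1983to89.B6Geom246MultiLevelBoxL0 (bset blkOf exists_blkOf_eq lev_eq_of_blkOf_eq)
open Literature.MathematicalPhysics.QuantumFieldTheory.Balaban1983to89.B6Ineq268MultiLevelBoxL0 (W W_eq)
open Literature.MathematicalPhysics.QuantumFieldTheory.Balaban1983to89.B6Expansion282 (kerOp)
open Literature.MathematicalPhysics.QuantumFieldTheory.Balaban1983to89.B8Ineq192MultiLevelTorusL0 (XkT kerOp_XkT)
open Literature.MathematicalPhysics.QuantumFieldTheory.Balaban1983to89.B6Prop23MultiLevelTorusL0 (GinvT BmT isUnit_BmT X_mul_GinvT GinvT_mul_X)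
open Literature.MathematicalPhysics.QuantumFieldTheory.Balaban1983to89.B6Ineq288MultiLevelTorusL0 (QM QsM toMatrix_QB toMatrix_QsB)
open Literature.MathematicalPhysics.QuantumFieldTheory.Balaban1983to89.B4Eq242TorusMirrors
open Literature.MathematicalPhysics.QuantumFieldTheory.Balaban1983to89.B4Eq242SignedImages (submatrix_perm_eq_of_mul_eq_one)
open Literature.MathematicalPhysics.QuantumFieldTheory.Balaban1983to89.B4Eq242SignedImagesFold (foldK foldK_apply compress_foldK_mul compress_foldK_mul_compress_foldK_eq_one)
open Literature.MathematicalPhysics.QuantumFieldTheory.Balaban1983to89.B4Eq242TorusMirrorsTiling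
open Literature.MathematicalPhysics.QuantumFieldTheory.Balaban1983to89.B6MultiLevelTorusMirrorL0
open Literature.MathematicalPhysics.QuantumFieldTheory.Balaban1983to89.B6MultiLevelTorusMirrorDirichlet (mlOpT_reflected_trefl)
open Literature.MathematicalPhysics.QuantumFieldTheory.Balaban1983to89.B6MultiLevelTorusMirrorImageFold (gmlT_reflected_trefl)
open Literature.MathematicalPhysics.QuantumFieldTheory.Balaban1983to89.B6MultiLevelTorusMirrorDecay (blkOf_trefl_eq_of_blkOf_eq)
open Literature.MathematicalPhysics.QuantumFieldTheory.Balaban1983to89.B6MultiLevelTorusMirrorBlockTiling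

variable {d : ℕ}
variable {ℓ Mh k R : ℕ} {P : Fin (d + 1) → ℕ} {k' : ℕ} {mir : Fin (d + 1) → Bool} {m : Fin (d + 1) → ℕ} {g : Fin (d + 1) → ℤ}
  {F : TDomains d ℓ Mh k P R} {hL : Odd (ℓ + 1)} {hM : Odd Mh} {hMh : 1 ≤ Mh} {hP : ∀ μ, 1 ≤ P μ} {hk : k' ≤ k} {hlev : ∀ x, F.lev x ≤ k'}
  {hm : ∀ μ, mir μ = true → 2 ≤ m μ} {hg : ∀ μ, sTop ℓ Mh k' ∣ g μ}

/-! ## §1  The block reflections of the reflected family; invariance of the averaging kernels -/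

section Blocks

/-- g31's block compatibility of the face reflections, in Part A's shape. [cite: Balaban1984PropagatorsII, (2.45) p.231; Balaban1983RegularityDecay, (2.42) p.584] -/
theorem blkOf_trefl_refl :
    ∀ (ε : Fin (d + 1) → Bool) (y y' : ↥(boxDom (N0 ℓ Mh k' (Pref ℓ k k' P mir m)))),
      blkOf (reflected F k' mir m g hL hM hMh hP hk hlev hm hg).toDomains y = blkOf (reflected F k' mir m g hL hM hMh hP hk hlev hm hg).toDomains y' →
      blkOf (reflected F k' mir m g hL hM hMh hP hk hlev hm hg).toDomains (trefl (hmir_of_top (k := k) (k' := k') (P := P) hL hM hMh hm) ε y) =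
        blkOf (reflected F k' mir m g hL hM hMh hP hk hlev hm hg).toDomains (trefl (hmir_of_top (k := k) (k' := k') (P := P) hL hM hMh hm) ε y') :=
  fun ε _ _ h => blkOf_trefl_eq_of_blkOf_eq (hL := hL) (hM := hM) (hMh := hMh) (hP := hP) (hk := hk) (hlev := hlev) (hm := hm) (hg := hg) ε h

/-- **THE BLOCK REFLECTIONS OF THE REFLECTED FAMILY** (Part A's `blkRefl` at g31's compatibility). [cite: Balaban1984PropagatorsII, (2.45) p.231; Balaban1983RegularityDecay, (2.42) p.584] -/
def blkReflR (F : TDomains d ℓ Mh k P R) (k' : ℕ) (mir : Fin (d + 1) → Bool) (m : Fin (d + 1) → ℕ) (g : Fin (d + 1) → ℤ)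
    (hL : Odd (ℓ + 1)) (hM : Odd Mh) (hMh : 1 ≤ Mh) (hP : ∀ μ, 1 ≤ P μ) (hk : k' ≤ k) (hlev : ∀ x, F.lev x ≤ k')
    (hm : ∀ μ, mir μ = true → 2 ≤ m μ) (hg : ∀ μ, sTop ℓ Mh k' ∣ g μ)
    (ε : Fin (d + 1) → Bool) : Equiv.Perm ↥(bset (reflected F k' mir m g hL hM hMh hP hk hlev hm hg).toDomains) :=
  blkRefl (blkOf_trefl_refl (F := F) (hL := hL) (hM := hM) (hMh := hMh) (hP := hP) (hk := hk) (hlev := hlev) (hm := hm) (hg := hg)) ε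

/-- `σ^{blk}_ε (y^j(x)) = y^j(σ_ε x)`. [cite: Balaban1984PropagatorsII, (2.45) p.231, bookkeeping] -/
theorem blkReflR_blkOf (ε : Fin (d + 1) → Bool) (y : ↥(boxDom (N0 ℓ Mh k' (Pref ℓ k k' P mir m)))) :
    blkReflR F k' mir m g hL hM hMh hP hk hlev hm hg ε (blkOf (reflected F k' mir m g hL hM hMh hP hk hlev hm hg).toDomains y) =
      blkOf (reflected F k' mir m g hL hM hMh hP hk hlev hm hg).toDomains (trefl (hmir_of_top (k := k) (k' := k') (P := P) hL hM hMh hm) ε y) :=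
  blkRefl_blkOf _ ε y

/-- membership in a reflected block: `y^j(σx) = σ^{blk}s ↔ y^j(x) = s`. [cite: Balaban1984PropagatorsII, (2.45) p.231, bookkeeping] -/
theorem blkOf_trefl_eq_iff (ε : Fin (d + 1) → Bool) (x : ↥(boxDom (N0 ℓ Mh k' (Pref ℓ k k' P mir m))))
    (s : ↥(bset (reflected F k' mir m g hL hM hMh hP hk hlev hm hg).toDomains)) :
    blkOf (reflected F k' mir m g hL hM hMh hP hk hlev hm hg).toDomains (trefl (hmir_of_top (k := k) (k' := k') (P := P) hL hM hMh hm) ε x) =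
        blkReflR F k' mir m g hL hM hMh hP hk hlev hm hg ε s ↔
      blkOf (reflected F k' mir m g hL hM hMh hP hk hlev hm hg).toDomains x = s := by
  rw [← blkReflR_blkOf]
  exact (blkReflR F k' mir m g hL hM hMh hP hk hlev hm hg ε).injective.eq_iff

/-- the weight `W = L^{j(d+1)}` of a block is reflection-invariant (levels are). [cite: Balaban1984PropagatorsII, (2.69) p.235, bookkeeping] -/
theorem W_blkReflR (ε : Fin (d + 1) → Bool) (s : ↥(bset (reflected F k' mir m g hL hM hMh hP hk hlev hm hg).toDomains)) :
    W (reflected F k' mir m g hL hM hMh hP hk hlev hm hg).toDomains (blkReflR F k' mir m g hL hM hMh hP hk hlev hm hg ε s) =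
      W (reflected F k' mir m g hL hM hMh hP hk hlev hm hg).toDomains s := by
  obtain ⟨y, rfl⟩ := exists_blkOf_eq (reflected F k' mir m g hL hM hMh hP hk hlev hm hg).toDomains s
  rw [blkReflR_blkOf, W_eq, W_eq]
  have h1 := lev_eq_of_blkOf_eq (reflected F k' mir m g hL hM hMh hP hk hlev hm hg).toDomains
    (rfl : blkOf _ (trefl (hmir_of_top (k := k) (k' := k') (P := P) hL hM hMh hm) ε y) = _)
  have h2 := lev_eq_of_blkOf_eq (reflected F k' mir m g hL hM hMh hP hk hlev hm hg).toDomains (rfl : blkOf _ y = _)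
  rw [← h1, ← h2]
  simp only [TDomains.toDomains_lev, reflected_lev]
  rw [levR_trefl]

/-- ★ **`Q̂′` IS JOINTLY INVARIANT**: `QM (σ^{blk}s) (σx) = QM s x`. [cite: Balaban1984PropagatorsII, (2.16)–(2.17) p.225; Balaban1983RegularityDecay, (2.42) p.584] -/
theorem QM_refl (ε : Fin (d + 1) → Bool) (s : ↥(bset (reflected F k' mir m g hL hM hMh hP hk hlev hm hg).toDomains))
    (x : ↥(boxDom (N0 ℓ Mh k' (Pref ℓ k k' P mir m)))) :
    QM (reflected F k' mir m g hL hM hMh hP hk hlev hm hg) (blkReflR F k' mir m g hL hM hMh hP hk hlev hm hg ε s)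
        (trefl (hmir_of_top (k := k) (k' := k') (P := P) hL hM hMh hm) ε x) =
      QM (reflected F k' mir m g hL hM hMh hP hk hlev hm hg) s x := by
  simp only [QM, W_blkReflR, blkOf_trefl_eq_iff]

/-- ★ **`Q̂′*` IS JOINTLY INVARIANT**: `QsM (σx) (σ^{blk}s) = QsM x s`. [cite: Balaban1984PropagatorsII, (2.17) p.225, (2.69) p.235; Balaban1983RegularityDecay, (2.42) p.584] -/
theorem QsM_refl (ε : Fin (d + 1) → Bool) (x : ↥(boxDom (N0 ℓ Mh k' (Pref ℓ k k' P mir m))))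
    (s : ↥(bset (reflected F k' mir m g hL hM hMh hP hk hlev hm hg).toDomains)) :
    QsM (reflected F k' mir m g hL hM hMh hP hk hlev hm hg) (trefl (hmir_of_top (k := k) (k' := k') (P := P) hL hM hMh hm) ε x)
        (blkReflR F k' mir m g hL hM hMh hP hk hlev hm hg ε s) =
      QsM (reflected F k' mir m g hL hM hMh hP hk hlev hm hg) x s := by
  simp only [QsM, blkOf_trefl_eq_iff]

end Blocks

/-! ## §2  The block word `X̂ = Q̂′Ĝ²Q̂′*` of the reflected family and its genuine inverse `Ĉ` -/

section Word

/-- **`X̂` — Prop. 2.3's `Q′G′²Q′*` of the reflected family, as a matrix on its blocks** (weights `a`). [cite: Balaban1984PropagatorsII, (2.17) p.225, (2.86) p.238] -/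
def xHat (F : TDomains d ℓ Mh k P R) (k' : ℕ) (mir : Fin (d + 1) → Bool) (m : Fin (d + 1) → ℕ) (g : Fin (d + 1) → ℤ)
    (hL : Odd (ℓ + 1)) (hM : Odd Mh) (hMh : 1 ≤ Mh) (hP : ∀ μ, 1 ≤ P μ) (hk : k' ≤ k) (hlev : ∀ x, F.lev x ≤ k')
    (hm : ∀ μ, mir μ = true → 2 ≤ m μ) (hg : ∀ μ, sTop ℓ Mh k' ∣ g μ)
    (a : ℕ → ℝ) : Matrix ↥(bset (reflected F k' mir m g hL hM hMh hP hk hlev hm hg).toDomains) ↥(bset (reflected F k' mir m g hL hM hMh hP hk hlev hm hg).toDomains) ℝ :=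
  LinearMap.toMatrix' (kerOp (W (reflected F k' mir m g hL hM hMh hP hk hlev hm hg).toDomains) (XkT (reflected F k' mir m g hL hM hMh hP hk hlev hm hg) a))

/-- **`Ĉ = X̂⁻¹` — Prop. 2.3's `(Q′G′²Q′*)⁻¹` of the reflected family, as a matrix** (`GinvT`). [cite: Balaban1984PropagatorsII, Prop. 2.3 (2.86)–(2.87) p.238] -/
def cHat (F : TDomains d ℓ Mh k P R) (k' : ℕ) (mir : Fin (d + 1) → Bool) (m : Fin (d + 1) → ℕ) (g : Fin (d + 1) → ℤ)
    (hL : Odd (ℓ + 1)) (hM : Odd Mh) (hMh : 1 ≤ Mh) (hP : ∀ μ, 1 ≤ P μ) (hk : k' ≤ k) (hlev : ∀ x, F.lev x ≤ k')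
    (hm : ∀ μ, mir μ = true → 2 ≤ m μ) (hg : ∀ μ, sTop ℓ Mh k' ∣ g μ)
    (a : ℕ → ℝ) : Matrix ↥(bset (reflected F k' mir m g hL hM hMh hP hk hlev hm hg).toDomains) ↥(bset (reflected F k' mir m g hL hM hMh hP hk hlev hm hg).toDomains) ℝ :=
  LinearMap.toMatrix' (GinvT (reflected F k' mir m g hL hM hMh hP hk hlev hm hg) a)

/-- `X̂ = QM·Ĝ·Ĝ·QsM`. [cite: Balaban1984PropagatorsII, (2.17) p.225, (2.69) p.235, bookkeeping] -/
theorem xHat_eq (a : ℕ → ℝ) :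
    xHat F k' mir m g hL hM hMh hP hk hlev hm hg a =
      QM (reflected F k' mir m g hL hM hMh hP hk hlev hm hg) * gmlT (N0 ℓ Mh k' (Pref ℓ k k' P mir m)) ℓ k' (reflected F k' mir m g hL hM hMh hP hk hlev hm hg).lev a *
        gmlT (N0 ℓ Mh k' (Pref ℓ k k' P mir m)) ℓ k' (reflected F k' mir m g hL hM hMh hP hk hlev hm hg).lev a * QsM (reflected F k' mir m g hL hM hMh hP hk hlev hm hg) := by
  rw [xHat, kerOp_XkT, LinearMap.toMatrix'_comp, LinearMap.toMatrix'_comp, LinearMap.toMatrix'_comp, LinearMap.toMatrix'_toLin', toMatrix_QB, toMatrix_QsB]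
  simp only [Matrix.mul_assoc]

variable {a : ℕ → ℝ} {aplus : ℝ}

/-- ★ **BOTH INVERSE LAWS `X̂Ĉ = 1 = ĈX̂`** (NO threshold: the conjugated kernel is coercive, `isUnit_BmT`). [cite: Balaban1984PropagatorsII, p.235 («its inverse is well defined»), Prop. 2.3 p.238] -/
theorem xHat_mul_cHat (hℓ : 1 ≤ ℓ) (ha : ∀ j, 0 < a j) (hale : ∀ j, a j ≤ aplus) :
    xHat F k' mir m g hL hM hMh hP hk hlev hm hg a * cHat F k' mir m g hL hM hMh hP hk hlev hm hg a = 1 ∧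
      cHat F k' mir m g hL hM hMh hP hk hlev hm hg a * xHat F k' mir m g hL hM hMh hP hk hlev hm hg a = 1 := by
  have hP' : ∀ μ, 1 ≤ Pref ℓ k k' P mir m μ := fun μ => by
    unfold Pref
    split_ifs with hμ
    · have := hm μ hμ; omega
    · exact le_trans (hP μ) (Nat.le_mul_of_pos_left _ (Nat.pow_pos (Nat.succ_pos ℓ)))
  have hU := isUnit_BmT (reflected F k' mir m g hL hM hMh hP hk hlev hm hg) a hℓ hMh hP' ha hale
  constructor
  · have h := congrArg LinearMap.toMatrix' (X_mul_GinvT (reflected F k' mir m g hL hM hMh hP hk hlev hm hg) a hU)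
    rw [LinearMap.toMatrix'_mul, LinearMap.toMatrix'_one] at h
    exact h
  · have h := congrArg LinearMap.toMatrix' (GinvT_mul_X (reflected F k' mir m g hL hM hMh hP hk hlev hm hg) a hU)
    rw [LinearMap.toMatrix'_mul, LinearMap.toMatrix'_one] at h
    exact h

/-- ★ **`X̂` IS JOINTLY INVARIANT under the block reflections** (its factors are). [cite: Balaban1983RegularityDecay, (2.42) p.584; Balaban1984PropagatorsII, (2.17) p.225] -/
theorem xHat_refl (ha : ∀ j, 0 < a j) (ε : Fin (d + 1) → Bool) (s t : ↥(bset (reflected F k' mir m g hL hM hMh hP hk hlev hm hg).toDomains)) :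
    xHat F k' mir m g hL hM hMh hP hk hlev hm hg a (blkReflR F k' mir m g hL hM hMh hP hk hlev hm hg ε s) (blkReflR F k' mir m g hL hM hMh hP hk hlev hm hg ε t) =
      xHat F k' mir m g hL hM hMh hP hk hlev hm hg a s t := by
  classical
  rw [xHat_eq]
  simp only [Matrix.mul_apply]
  -- reindex every intermediate site sum along the involution `σ_ε`
  rw [← Equiv.sum_comp (trefl (hmir_of_top (k := k) (k' := k') (P := P) hL hM hMh hm) ε)]
  refine Finset.sum_congr rfl fun x₃ _ => ?_
  rw [QsM_refl]
  congr 1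
  rw [← Equiv.sum_comp (trefl (hmir_of_top (k := k) (k' := k') (P := P) hL hM hMh hm) ε)]
  refine Finset.sum_congr rfl fun x₂ _ => ?_
  rw [gmlT_reflected_trefl a ha ε x₂ x₃]
  congr 1
  rw [← Equiv.sum_comp (trefl (hmir_of_top (k := k) (k' := k') (P := P) hL hM hMh hm) ε)]
  refine Finset.sum_congr rfl fun x₁ _ => ?_
  rw [QM_refl, gmlT_reflected_trefl a ha ε x₁ x₂]

/-- ★ **`Ĉ` IS JOINTLY INVARIANT** (the inverse of an invariant matrix is invariant, D1 `submatrix_perm_eq_of_mul_eq_one`). [cite: Balaban1983RegularityDecay, (2.42) p.584; Balaban1984PropagatorsII, Prop. 2.3 p.238] -/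
theorem cHat_refl (hℓ : 1 ≤ ℓ) (ha : ∀ j, 0 < a j) (hale : ∀ j, a j ≤ aplus) (ε : Fin (d + 1) → Bool)
    (s t : ↥(bset (reflected F k' mir m g hL hM hMh hP hk hlev hm hg).toDomains)) :
    cHat F k' mir m g hL hM hMh hP hk hlev hm hg a (blkReflR F k' mir m g hL hM hMh hP hk hlev hm hg ε s) (blkReflR F k' mir m g hL hM hMh hP hk hlev hm hg ε t) =
      cHat F k' mir m g hL hM hMh hP hk hlev hm hg a s t :=
  submatrix_perm_eq_of_mul_eq_one (xHat_mul_cHat hℓ ha hale).1 (fun u w => xHat_refl ha ε u w) s t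

end Word

/-! ## §3  The compressed fold of `X̂` is the product of the four compressed folds (engine §2 over the SITE carrier, thrice) -/

section FoldProduct

variable {a : ℕ → ℝ}

/-- the open mirror box of the doubled torus (D2's `mirBoxOpen` at g31's mirror data). [cite: Balaban1985BackgroundPropagators, p.394 («Ω₀»); Balaban1983RegularityDecay, (2.42) p.584, dictionary] -/
abbrev boxR (ℓ Mh k k' : ℕ) (P : Fin (d + 1) → ℕ) (mir : Fin (d + 1) → Bool) (m : Fin (d + 1) → ℕ) : Finset ↥(boxDom (N0 ℓ Mh k' (Pref ℓ k k' P mir m))) :=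
  mirBoxOpen (N0 ℓ Mh k' (Pref ℓ k k' P mir m)) mir (nMir ℓ Mh k' m) (fun _ => hMir ℓ Mh k')

/-- ★ `fold(QM)|·fold(Ĝ)| = fold(QM·Ĝ)|` (middle carrier = sites; `Ĝ` jointly invariant). [cite: Balaban1983RegularityDecay, (2.42) p.584; Balaban1984PropagatorsII, (2.17) p.225] -/
theorem fold_QM_mul_fold_G (ha : ∀ j, 0 < a j) (X₁ : Finset ↥(bset (reflected F k' mir m g hL hM hMh hP hk hlev hm hg).toDomains)) :
    (foldK (mirIdx mir) (trefl (hmir_of_top (k := k) (k' := k') (P := P) hL hM hMh hm)) (tsign ℝ mir) (QM (reflected F k' mir m g hL hM hMh hP hk hlev hm hg))).submatrix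
        (fun v : ↥X₁ => (v : _)) (fun v : ↥(boxR ℓ Mh k k' P mir m) => (v : _)) *
      (foldK (mirIdx mir) (trefl (hmir_of_top (k := k) (k' := k') (P := P) hL hM hMh hm)) (tsign ℝ mir)
          (gmlT (N0 ℓ Mh k' (Pref ℓ k k' P mir m)) ℓ k' (reflected F k' mir m g hL hM hMh hP hk hlev hm hg).lev a)).submatrix
        (fun v : ↥(boxR ℓ Mh k k' P mir m) => (v : _)) (fun v : ↥(boxR ℓ Mh k k' P mir m) => (v : _)) =
      (foldK (mirIdx mir) (trefl (hmir_of_top (k := k) (k' := k') (P := P) hL hM hMh hm)) (tsign ℝ mir)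
          (QM (reflected F k' mir m g hL hM hMh hP hk hlev hm hg) * gmlT (N0 ℓ Mh k' (Pref ℓ k k' P mir m)) ℓ k' (reflected F k' mir m g hL hM hMh hP hk hlev hm hg).lev a)).submatrix
        (fun v : ↥X₁ => (v : _)) (fun v : ↥(boxR ℓ Mh k k' P mir m) => (v : _)) := by
  obtain ⟨hmem, hσ, hs, hbij⟩ := site_closure (hmir := hmir_of_top (k := k) (k' := k') (P := P) hL hM hMh hm) (R := ℝ)
  exact compress_foldK_mul (mirIdx mir) (tsign ℝ mir) _ _ xorIdx X₁ _ _ hmem hσ hs hbij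
    (fun ε _ u w => gmlT_reflected_trefl a ha ε u w) site_tiling
    (site_cancel _ trefl_flipAt' _ (fun μ _ u v => gmlT_reflected_trefl a ha (single μ) u v)) _

/-- ★★ **THE COMPRESSED FOLD OF `X̂` IS THE PRODUCT OF THE FOUR COMPRESSED FOLDS**: `fold(QM)|·fold(Ĝ)|·fold(Ĝ)|·fold(QsM)| = fold(X̂)|`, rows ∕ columns over any block sets
`X₁`, `X₃`, sites over the open mirror box, the last fold along the BLOCK reflections. [cite: Balaban1983RegularityDecay, (2.42) p.584; Balaban1984PropagatorsII, (2.17) p.225, (2.86) p.238; Balaban1985BackgroundPropagators, (3.25) p.394] -/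
theorem fold_xHat_eq_prod (ha : ∀ j, 0 < a j) (X₁ X₃ : Finset ↥(bset (reflected F k' mir m g hL hM hMh hP hk hlev hm hg).toDomains)) :
    (foldK (mirIdx mir) (trefl (hmir_of_top (k := k) (k' := k') (P := P) hL hM hMh hm)) (tsign ℝ mir) (QM (reflected F k' mir m g hL hM hMh hP hk hlev hm hg))).submatrix
        (fun v : ↥X₁ => (v : _)) (fun v : ↥(boxR ℓ Mh k k' P mir m) => (v : _)) *
      (foldK (mirIdx mir) (trefl (hmir_of_top (k := k) (k' := k') (P := P) hL hM hMh hm)) (tsign ℝ mir)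
          (gmlT (N0 ℓ Mh k' (Pref ℓ k k' P mir m)) ℓ k' (reflected F k' mir m g hL hM hMh hP hk hlev hm hg).lev a)).submatrix
        (fun v : ↥(boxR ℓ Mh k k' P mir m) => (v : _)) (fun v : ↥(boxR ℓ Mh k k' P mir m) => (v : _)) *
      (foldK (mirIdx mir) (trefl (hmir_of_top (k := k) (k' := k') (P := P) hL hM hMh hm)) (tsign ℝ mir)
          (gmlT (N0 ℓ Mh k' (Pref ℓ k k' P mir m)) ℓ k' (reflected F k' mir m g hL hM hMh hP hk hlev hm hg).lev a)).submatrix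
        (fun v : ↥(boxR ℓ Mh k k' P mir m) => (v : _)) (fun v : ↥(boxR ℓ Mh k k' P mir m) => (v : _)) *
      (foldK (mirIdx mir) (blkReflR F k' mir m g hL hM hMh hP hk hlev hm hg) (tsign ℝ mir) (QsM (reflected F k' mir m g hL hM hMh hP hk hlev hm hg))).submatrix
        (fun v : ↥(boxR ℓ Mh k k' P mir m) => (v : _)) (fun v : ↥X₃ => (v : _)) =
      (foldK (mirIdx mir) (blkReflR F k' mir m g hL hM hMh hP hk hlev hm hg) (tsign ℝ mir) (xHat F k' mir m g hL hM hMh hP hk hlev hm hg a)).submatrix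
        (fun v : ↥X₁ => (v : _)) (fun v : ↥X₃ => (v : _)) := by
  obtain ⟨hmem, hσ, hs, hbij⟩ := site_closure (hmir := hmir_of_top (k := k) (k' := k') (P := P) hL hM hMh hm) (R := ℝ)
  have hσb : ∀ ε ∈ mirIdx mir, ∀ ε' ∈ mirIdx mir, blkReflR F k' mir m g hL hM hMh hP hk hlev hm hg (xorIdx ε ε') =
      blkReflR F k' mir m g hL hM hMh hP hk hlev hm hg ε * blkReflR F k' mir m g hL hM hMh hP hk hlev hm hg ε' := fun ε _ ε' _ => blkRefl_xorIdx _ ε ε'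
  have hG : ∀ ε ∈ mirIdx mir, ∀ u w, gmlT (N0 ℓ Mh k' (Pref ℓ k k' P mir m)) ℓ k' (reflected F k' mir m g hL hM hMh hP hk hlev hm hg).lev a
      (trefl (hmir_of_top (k := k) (k' := k') (P := P) hL hM hMh hm) ε u) (trefl (hmir_of_top (k := k) (k' := k') (P := P) hL hM hMh hm) ε w) =
      gmlT (N0 ℓ Mh k' (Pref ℓ k k' P mir m)) ℓ k' (reflected F k' mir m g hL hM hMh hP hk hlev hm hg).lev a u w := fun ε _ u w => gmlT_reflected_trefl a ha ε u w
  have hGcancel := site_cancel (hmir := hmir_of_top (k := k) (k' := k') (P := P) hL hM hMh hm) (R := ℝ) _ trefl_flipAt'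
    (gmlT (N0 ℓ Mh k' (Pref ℓ k k' P mir m)) ℓ k' (reflected F k' mir m g hL hM hMh hP hk hlev hm hg).lev a) (fun μ _ u v => gmlT_reflected_trefl a ha (single μ) u v)
  have hQs : ∀ ε ∈ mirIdx mir, ∀ u w, QsM (reflected F k' mir m g hL hM hMh hP hk hlev hm hg) (trefl (hmir_of_top (k := k) (k' := k') (P := P) hL hM hMh hm) ε u)
      (blkReflR F k' mir m g hL hM hMh hP hk hlev hm hg ε w) = QsM (reflected F k' mir m g hL hM hMh hP hk hlev hm hg) u w := fun ε _ u w => QsM_refl ε u w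
  have hQscancel := site_cancel (hmir := hmir_of_top (k := k) (k' := k') (P := P) hL hM hMh hm) (R := ℝ) (blkReflR F k' mir m g hL hM hMh hP hk hlev hm hg)
    (blkRefl_flipAt' _) (QsM (reflected F k' mir m g hL hM hMh hP hk hlev hm hg)) (fun μ _ u v => QsM_refl (single μ) u v)
  -- three applications of the engine over the site carrier
  rw [compress_foldK_mul (mirIdx mir) (tsign ℝ mir) _ _ xorIdx X₁ _ _ hmem hσ hs hbij hG site_tiling hGcancel _,
    compress_foldK_mul (mirIdx mir) (tsign ℝ mir) _ _ xorIdx X₁ _ _ hmem hσ hs hbij hG site_tiling hGcancel _,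
    compress_foldK_mul (mirIdx mir) (tsign ℝ mir) _ _ xorIdx X₁ _ X₃ hmem hσb hs hbij hQs site_tiling hQscancel _, xHat_eq]

end FoldProduct

/-! ## §4  ★★★ The compressed fold of `X̂` is inverted by the compressed fold of `Ĉ` on the blocks inside the open box (engine §3 over the BLOCK carrier) -/

section Inverse

variable {a : ℕ → ℝ} {aplus : ℝ}

/-- ★★★ **THE DIRICHLET BLOCK INVERSE BY SIGNED IMAGES**: under the MARGIN binder (a block of the reflected family meeting the open box lies in it), on the blocks INSIDE the
open box `fold(X̂)| · fold(Ĉ)| = 1` — the compression of the folded block word is inverted exactly by the compressed fold of Prop. 2.3's inverse.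
[cite: Balaban1983RegularityDecay, (2.42) p.584 («it is enough to prove (2.35), (2.36) for the propagator G_j»); Balaban1984PropagatorsII, Prop. 2.3 (2.87) p.238; Balaban1985BackgroundPropagators, p.394, Thm 3.2 p.398, p.409 l.1–5] -/
theorem compress_fold_xHat_mul_compress_fold_cHat (hℓ : 1 ≤ ℓ) (ha : ∀ j, 0 < a j) (hale : ∀ j, a j ≤ aplus)
    (hmarg : ∀ x ∈ boxR ℓ Mh k k' P mir m, ∀ z : ↥(boxDom (N0 ℓ Mh k' (Pref ℓ k k' P mir m))),
      blkOf (reflected F k' mir m g hL hM hMh hP hk hlev hm hg).toDomains z = blkOf (reflected F k' mir m g hL hM hMh hP hk hlev hm hg).toDomains x →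
        z ∈ boxR ℓ Mh k k' P mir m) :
    (foldK (mirIdx mir) (blkReflR F k' mir m g hL hM hMh hP hk hlev hm hg) (tsign ℝ mir) (xHat F k' mir m g hL hM hMh hP hk hlev hm hg a)).submatrix
        (fun v : ↥(blkInside (reflected F k' mir m g hL hM hMh hP hk hlev hm hg) (boxR ℓ Mh k k' P mir m)) => (v : _))
        (fun v : ↥(blkInside (reflected F k' mir m g hL hM hMh hP hk hlev hm hg) (boxR ℓ Mh k k' P mir m)) => (v : _)) *
      (foldK (mirIdx mir) (blkReflR F k' mir m g hL hM hMh hP hk hlev hm hg) (tsign ℝ mir) (cHat F k' mir m g hL hM hMh hP hk hlev hm hg a)).submatrix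
        (fun v : ↥(blkInside (reflected F k' mir m g hL hM hMh hP hk hlev hm hg) (boxR ℓ Mh k k' P mir m)) => (v : _))
        (fun v : ↥(blkInside (reflected F k' mir m g hL hM hMh hP hk hlev hm hg) (boxR ℓ Mh k k' P mir m)) => (v : _)) = 1 := by
  have hblk := blkOf_trefl_refl (F := F) (hL := hL) (hM := hM) (hMh := hMh) (hP := hP) (hk := hk) (hlev := hlev) (hm := hm) (hg := hg)
  obtain ⟨hmem, -, hs, hbij⟩ := site_closure (hmir := hmir_of_top (k := k) (k' := k') (P := P) hL hM hMh hm) (R := ℝ)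
  have hσb : ∀ ε ∈ mirIdx mir, ∀ ε' ∈ mirIdx mir, blkReflR F k' mir m g hL hM hMh hP hk hlev hm hg (xorIdx ε ε') =
      blkReflR F k' mir m g hL hM hMh hP hk hlev hm hg ε * blkReflR F k' mir m g hL hM hMh hP hk hlev hm hg ε' := fun ε _ ε' _ => blkRefl_xorIdx _ ε ε'
  have hbot : blkReflR F k' mir m g hL hM hMh hP hk hlev hm hg (fun _ => false) = 1 := blkRefl_bot _
  have hC : ∀ ε ∈ mirIdx mir, ∀ u w, cHat F k' mir m g hL hM hMh hP hk hlev hm hg a (blkReflR F k' mir m g hL hM hMh hP hk hlev hm hg ε u)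
      (blkReflR F k' mir m g hL hM hMh hP hk hlev hm hg ε w) = cHat F k' mir m g hL hM hMh hP hk hlev hm hg a u w := fun ε _ u w => cHat_refl hℓ ha hale ε u w
  exact compress_foldK_mul_compress_foldK_eq_one (mirIdx mir) (tsign ℝ mir) (blkReflR F k' mir m g hL hM hMh hP hk hlev hm hg) xorIdx _ hmem hσb hs hbij
    bot_mem_mirIdx hbot tsign_bot (block_free hblk) (xHat_mul_cHat hℓ ha hale).1 hC (block_tiling hblk)
    (block_cancel hblk hmarg (blkReflR F k' mir m g hL hM hMh hP hk hlev hm hg) (blkRefl_flipAt' hblk) _ (fun μ _ u v => cHat_refl hℓ ha hale (single μ) u v))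

/-- ★ … and on the other side. [cite: Balaban1983RegularityDecay, (2.42) p.584; Balaban1984PropagatorsII, Prop. 2.3 p.238] -/
theorem compress_fold_cHat_mul_compress_fold_xHat (hℓ : 1 ≤ ℓ) (ha : ∀ j, 0 < a j) (hale : ∀ j, a j ≤ aplus)
    (hmarg : ∀ x ∈ boxR ℓ Mh k k' P mir m, ∀ z : ↥(boxDom (N0 ℓ Mh k' (Pref ℓ k k' P mir m))),
      blkOf (reflected F k' mir m g hL hM hMh hP hk hlev hm hg).toDomains z = blkOf (reflected F k' mir m g hL hM hMh hP hk hlev hm hg).toDomains x →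
        z ∈ boxR ℓ Mh k k' P mir m) :
    (foldK (mirIdx mir) (blkReflR F k' mir m g hL hM hMh hP hk hlev hm hg) (tsign ℝ mir) (cHat F k' mir m g hL hM hMh hP hk hlev hm hg a)).submatrix
        (fun v : ↥(blkInside (reflected F k' mir m g hL hM hMh hP hk hlev hm hg) (boxR ℓ Mh k k' P mir m)) => (v : _))
        (fun v : ↥(blkInside (reflected F k' mir m g hL hM hMh hP hk hlev hm hg) (boxR ℓ Mh k k' P mir m)) => (v : _)) *
      (foldK (mirIdx mir) (blkReflR F k' mir m g hL hM hMh hP hk hlev hm hg) (tsign ℝ mir) (xHat F k' mir m g hL hM hMh hP hk hlev hm hg a)).submatrix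
        (fun v : ↥(blkInside (reflected F k' mir m g hL hM hMh hP hk hlev hm hg) (boxR ℓ Mh k k' P mir m)) => (v : _))
        (fun v : ↥(blkInside (reflected F k' mir m g hL hM hMh hP hk hlev hm hg) (boxR ℓ Mh k k' P mir m)) => (v : _)) = 1 :=
  mul_eq_one_comm.1 (compress_fold_xHat_mul_compress_fold_cHat hℓ ha hale hmarg)

end Inverse

end

end Literature.MathematicalPhysics.QuantumFieldTheory.Balaban1983to89.B6MultiLevelTorusMirrorBlockLetter
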